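import Summits.QuantumFields.YangMills.Theorems.BalabanUVNodesN26AtRecord8
import Summits.QuantumFields.YangMills.Theorems.BalabanUVNodesClustersCore
import Literature.MathematicalPhysics.QuantumFieldTheory.Balaban1983to89.Node00.Record8Chart
import Literature.MathematicalPhysics.QuantumFieldTheory.Balaban1983to89.Node00.ChartOfRecord

/-!
# DAG node N26 — B4 «β-continuity» AT THE CHARTED Stage-8 record `Node00.IsRecordOfRecord₈X` (n23-b's chart clause of record
# `Stage8Params.IsChartOfRecord`, p418120): the ∀-FORM OF RECORD per chair R445 (A)(a2) — socket inputs asked ONLY of admissible θ carrying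
# the chart of record — and the route supply's `YMDAG.UVSplit.N26_B4lit` at `Rec := IsRecordOfRecord₈X`, BY NAME

Cell `pub-ymgap`, YM-PLAN Track A (HUMAN RULING D-0062), seat `pub-ymgap-dag-n26-a` (gen 3; -a = KNIT-BY-NAME); ninth N26 companion.  STATUS OF
RECORD: N26 = binder B4 is DEPENDENT on (D4) and VACATED in the discharge form of record (closes WITH B3 = N25, NODE O); instance 0∕1.
ZEROCHART (ref-D control rule v0.33, chair R445 (A), director-ym LINE №31): over the UNCHARTED predicate `IsRecordOfRecord₈C` the ∃-form is
content-free (zero chart; `BalabanUVNodesN26B4litAtRecord` §3) and the countable shape is the ∀-form over every admissible θ WITH A DISPLAYED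
non-degenerate chart; n23-b's `Node00.Record8Chart` supplies that chart clause (`IsSuChart`: values in 𝔰𝔲(N), onto, `hsForm`-orthogonal basis), the
amended predicate `IsRecordOfRecord₈X` (inhabited at every `N ≥ 1`: `Node00.exists_isRecordOfRecord₈X`; print's Pauli chart at `N = 2`:
`Node00.Stage8Params.rechartPauli`, `Node00.betaOfRecord₈_rechartPauli`), and the exclusion of the zero chart (`IsChartOfRecord.rho8_ne_zero`, `2 ≤ N`).

WHAT IS HERE (compositions BY NAME; no definition, no estimate, 0 `sorry`):
* §1 `n26_of_isRecordOfRecord₈X` — N26's literal at a CHARTED record from the (D4) socket inputs for θ's OWN merged term family, asked only of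
  admissible θ CARRYING THE CHART OF RECORD (`θ.IsChartOfRecord c`, `0 < c`) and realising the datum (gen 2's `n26_datumOfRecord₈`).
* §2 `n26_B4lit_mono` (the route's `N26_B4lit Rec` is antitone in `Rec`), `n26_B4lit_rec8X` (THE ∀-FORM OF RECORD: `N26_B4lit (IsRecordOfRecord₈X …)`
  from §1), `n26_B4lit_rec8X_of_rec8C` (… or from the ₈C form by refinement `isRecordOfRecord₈C_of_isRecordOfRecord₈X`).
* §3 (plan g62's (W2′) rider) `n26lit_congr_βfun` (N26 reads the datum only through `βfun`), `n26_B4lit_of_shadow` (a record predicate whose records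
  have `Rec'`-shadows with the same `βfun` and world inherits `N26_B4lit` from `Rec'` — the Stage-9 transfer shape, no re-keying).
LOCATED CAVEAT (this seat's [LOCATED-B4-VERSION ∕ -RSTEP], pub-ymgap INBOX l.10515; plan g62 (I3-version)): at Stage 8 the socket inputs `hrep` ∕
`hcont` ∕ `hβ0` are statements about second derivatives at a point of a Radon–Nikodym VERSION (`Node00.TrhoOfRecord`) and about a β generated with the
(2.17) χ of record (`R_k` a step function of `g_k`, `BalabanUVNodesN26BetaContChiStep`); they become decidable only at a Stage 9 with an explicit
β-layer transport and [I] (2.9)'s χ.  HONEST FRAMING: bookkeeping by name; nothing of Bałaban's asserted; N26 NOT discharged (instance 0∕1, closes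
WITH N25); one finite four-torus programme at fixed ε per run — NOT the continuum limit, NOT ℝ⁴, NOT OS, NOT a mass gap, NOT Clay.
[Balaban1987RG1] = T. Bałaban, Commun. Math. Phys. **109** (1987) 249–301: (1.20)–(1.22) p. 264; [Balaban1988RG2Cluster] = Commun. Math. Phys. **116**
(1988) 1–22: Lemma 3 (2.38) p. 20.
-/

noncomputable section

open scoped Matrix.Norms.L2Operator

namespace Summit.QuantumFields.YangMills.Theorems.BalabanUVNodesN26AtRecord8X

open Literature.MathematicalPhysics.QuantumFieldTheory.Balaban1983to89
open Literature.MathematicalPhysics.QuantumFieldTheory.Balaban1983to89.FlowStep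
open Literature.MathematicalPhysics.QuantumFieldTheory.Balaban1983to89.DagBinding (WorldP)
open Literature.MathematicalPhysics.QuantumFieldTheory.Balaban1983to89.T4Continuum (T4Family FiniteEpsData)
open Literature.MathematicalPhysics.QuantumFieldTheory.Balaban1983to89.Node00
open Literature.MathematicalPhysics.QuantumFieldTheory.Balaban1983to89.B13ScaleTransfer (Pt)
open Literature.MathematicalPhysics.QuantumFieldTheory.Balaban1983to89.Beta.RemainderChainLattice
open Literature.MathematicalPhysics.QuantumFieldTheory.Balaban1983to89.Beta.RemainderLimitTorus (LDom limKernel)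
open Literature.MathematicalPhysics.QuantumFieldTheory.Balaban1983to89.Beta.RemainderDecay190
open Literature.MathematicalPhysics.QuantumFieldTheory.Balaban1983to89.Beta.RemainderLocalityHolo (PolLeavesTFac190H)
open Filter Topology

section AtRecord

variable (F : T4Family) (N : ℕ) [NeZero N]

/-! ## §1 N26 at a CHARTED Stage-8 record: socket inputs asked only of θ carrying the chart of record -/

/-- **N26 AT A CHARTED STAGE-8 RECORD** `IsRecordOfRecord₈X F N D w`: the (D4) socket inputs — one-loop kernels `P0` pinned on the record's
`beta0OfMerged … θ.v₀` with (5.10), leaf kernels `A1` with [II]-(2.38)∕(190) records on the world's window, the localized representation `hrep` of the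
merged limit kernel, the side conditions, the history-continuity clause (C-pt) — asked ONLY of admissible θ CARRYING THE CHART OF RECORD
(`θ.IsChartOfRecord c`, `0 < c`: values in 𝔰𝔲(N), onto, `hsForm`-orthogonal basis; the zero chart is excluded for `2 ≤ N`,
`Node00.Stage8Params.IsChartOfRecord.rho8_ne_zero`) and realising the datum, give `∃ γc > 0, BetaContH γc D.βfun` (gen 2's `n26_datumOfRecord₈` BY
NAME at the ₈X witness's own θ; `0 < w.γ ≤ θ.γ` read off the predicate).  Declared hypotheses; instance 0∕1; N26 NOT discharged.
[cite: Balaban1987RG1, (1.7) p.261 and (1.20)-(1.22) p.264; Balaban1988RG2Cluster, Lemma 3 (2.38) p.20] -/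
theorem n26_of_isRecordOfRecord₈X {D : FiniteEpsData F (Matrix.specialUnitaryGroup (Fin N) ℂ)} {w : WorldP}
    (h : IsRecordOfRecord₈X F N D w)
    (hin : ∀ (θ : Stage8Params F N) (c₈ : ℝ), θ.Admissible → 0 < c₈ → θ.IsChartOfRecord c₈ →
      D = datumOfRecord₅ F N (θ.toStage5 F N) → w.γ ≤ θ.γ →
      letI := θ.instVβ₁; letI := θ.instVβ₂; letI := θ.instιβ
      ∃ (M : ℕ) (_ : NeZero M) (c : B13.Consts) (ℓ α₂ : ℝ) (q : Consts190) (P0 : ℕ → Pt 4 → ℝ)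
        (A1 : (k : ℕ) → (Fin (k + 1) → ℝ) → LDom 4 → Pt 4 → ℝ),
        (∀ k, beta0OfMerged (betaMerged F (mergedTermFamilyMat F N (chi7 F N θ) θ.εbg) θ.ρ8 θ.bV) θ.v₀ k =
          B12Beta.secondMoment (fun _ _ => P0 k) 0 1) ∧
        (∀ k, ∃ C δ₁ : ℝ, 0 < δ₁ ∧ B12Sec2to5.Decay510 (P0 k) C δ₁) ∧
        (∀ k (p : Fin (k + 1) → ℝ), p ∈ Box w.γ k → ∀ z : Pt 4,
          polLimit F (k + 1) (fun K => mergedTermFamilyMat F N (chi7 F N θ) θ.εbg k p K) θ.ρ8 θ.bV 0 1 z =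
            P0 k z + limKernel (A1 k p) z) ∧
        (∀ k (p : Fin (k + 1) → ℝ), p ∈ Box w.γ k → Nonempty (PolLeavesTFac190H 4 M (A1 k p) c ℓ α₂ q)) ∧
        CondsL 4 c ℓ ∧ c.R22gen ℓ ∧ q.Valid c.δ₀ ∧ SignsL c α₂ q.B₃ ∧
        (∀ k (z : Pt 4), ContinuousOn (fun p : Fin (k + 1) → ℝ =>
          polLimit F (k + 1) (fun K => mergedTermFamilyMat F N (chi7 F N θ) θ.εbg k p K) θ.ρ8 θ.bV 0 1 z) (Box w.γ k))) :
    ∃ γc : ℝ, 0 < γc ∧ BetaContH γc D.βfun := by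
  obtain ⟨θ, c₈, hθ, hc₈, hch, hD, -, ⟨hγ0, hγle⟩, -, -⟩ := h
  obtain ⟨M, _, c, ℓ, α₂, q, P0, A1, hβ0, hP0, hrep, hleaves, hC, h22, hq, hs, hcont⟩ := hin θ c₈ hθ hc₈ hch hD hγle
  subst hD
  exact BalabanUVNodesN26AtRecord8.n26_datumOfRecord₈ F N θ hγ0 hγle P0 hβ0 hP0 A1 hrep
    (fun k p hp => Classical.choice (hleaves k p hp)) hC h22 hq hs hcont

end AtRecord

/-! ## §2 The route supply's `N26_B4lit` at `Rec := IsRecordOfRecord₈X` — the ∀-form of record -/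

section Route

variable {N : ℕ} [NeZero N]

/-- `N26_B4lit Rec` is ANTITONE in the record predicate: a finer predicate inherits it. [cite: Balaban1987RG1, (1.22) p.264 (bookkeeping)] -/
theorem n26_B4lit_mono {Rec Rec' : YMDAG.UVSplit.RecordPred N}
    (h : ∀ (F : T4Family) (D : FiniteEpsData F (Matrix.specialUnitaryGroup (Fin N) ℂ)) (w : WorldP), Rec' F D w → Rec F D w)
    (h26 : YMDAG.UVSplit.N26_B4lit Rec) : YMDAG.UVSplit.N26_B4lit Rec' :=
  fun F D w hw => h26 F D w (h F D w hw)

/-- **`N26_B4lit` AT THE CHARTED STAGE-8 RECORD PREDICATE — THE ∀-FORM OF RECORD** (chair R445 (A)(a2): every F, every record pair, EVERY admissible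
θ carrying the chart of record and realising the datum), from the (D4) socket inputs for θ's own merged term family (§1).  Instance 0∕1; N26 NOT
discharged. [cite: Balaban1987RG1, (1.7) p.261 and (1.20)-(1.22) p.264; Balaban1988RG2Cluster, Lemma 3 (2.38) p.20] -/
theorem n26_B4lit_rec8X
    (hin : ∀ (F : T4Family) (D : FiniteEpsData F (Matrix.specialUnitaryGroup (Fin N) ℂ)) (w : WorldP) (θ : Stage8Params F N) (c₈ : ℝ),
      θ.Admissible → 0 < c₈ → θ.IsChartOfRecord c₈ → D = datumOfRecord₅ F N (θ.toStage5 F N) → w.γ ≤ θ.γ →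
      letI := θ.instVβ₁; letI := θ.instVβ₂; letI := θ.instιβ
      ∃ (M : ℕ) (_ : NeZero M) (c : B13.Consts) (ℓ α₂ : ℝ) (q : Consts190) (P0 : ℕ → Pt 4 → ℝ)
        (A1 : (k : ℕ) → (Fin (k + 1) → ℝ) → LDom 4 → Pt 4 → ℝ),
        (∀ k, beta0OfMerged (betaMerged F (mergedTermFamilyMat F N (chi7 F N θ) θ.εbg) θ.ρ8 θ.bV) θ.v₀ k =
          B12Beta.secondMoment (fun _ _ => P0 k) 0 1) ∧
        (∀ k, ∃ C δ₁ : ℝ, 0 < δ₁ ∧ B12Sec2to5.Decay510 (P0 k) C δ₁) ∧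
        (∀ k (p : Fin (k + 1) → ℝ), p ∈ Box w.γ k → ∀ z : Pt 4,
          polLimit F (k + 1) (fun K => mergedTermFamilyMat F N (chi7 F N θ) θ.εbg k p K) θ.ρ8 θ.bV 0 1 z =
            P0 k z + limKernel (A1 k p) z) ∧
        (∀ k (p : Fin (k + 1) → ℝ), p ∈ Box w.γ k → Nonempty (PolLeavesTFac190H 4 M (A1 k p) c ℓ α₂ q)) ∧
        CondsL 4 c ℓ ∧ c.R22gen ℓ ∧ q.Valid c.δ₀ ∧ SignsL c α₂ q.B₃ ∧
        (∀ k (z : Pt 4), ContinuousOn (fun p : Fin (k + 1) → ℝ =>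
          polLimit F (k + 1) (fun K => mergedTermFamilyMat F N (chi7 F N θ) θ.εbg k p K) θ.ρ8 θ.bV 0 1 z) (Box w.γ k))) :
    YMDAG.UVSplit.N26_B4lit (fun F D w => IsRecordOfRecord₈X F N D w) :=
  fun F D w h => n26_of_isRecordOfRecord₈X F N h (hin F D w)

/-- … or from the UNCHARTED ₈C form by refinement (`Node00.isRecordOfRecord₈C_of_isRecordOfRecord₈X`): whoever supplies the socket for EVERY admissible θ
supplies it in particular for the charted ones. [cite: Balaban1987RG1, (1.22) p.264 (bookkeeping)] -/
theorem n26_B4lit_rec8X_of_rec8C (h : YMDAG.UVSplit.N26_B4lit (fun F D w => IsRecordOfRecord₈C F N D w)) :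
    YMDAG.UVSplit.N26_B4lit (fun F D w => IsRecordOfRecord₈X F N D w) :=
  n26_B4lit_mono (fun _ _ _ hw => isRecordOfRecord₈C_of_isRecordOfRecord₈X hw) h

end Route

/-! ## §3 (W2′) transfer shape (plan g62's rider, pub-ymgap INBOX l.10686): N26 reads the datum ONLY through `D.βfun` -/

section Transfer

/-- N26's literal depends on the datum only through its β-family: data agreeing on `βfun` have the same N26.
[cite: Balaban1987RG1, (1.22) p.264 (bookkeeping)] -/
theorem n26lit_congr_βfun {F : T4Family} {G : Type*} [GaugeGroup G] [MeasurableSpace G] [HaarData G]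
    {D D' : FiniteEpsData F G} (h : D.βfun = D'.βfun) :
    (∃ γc : ℝ, 0 < γc ∧ BetaContH γc D.βfun) ↔ (∃ γc : ℝ, 0 < γc ∧ BetaContH γc D'.βfun) := by
  rw [h]

variable {N : ℕ} [NeZero N]

/-- **SHADOW TRANSFER for the route's `N26_B4lit`** (plan's (W2′): a Stage-9 record need not refine Stage 5∕8 at the DATUM, only at a SHADOW datum
with the same world and agreeing data): if every `Rec`-record `(D, w)` has a `Rec'`-record shadow `(D', w)` with `D'.βfun = D.βfun`, then
`N26_B4lit Rec'` gives `N26_B4lit Rec` — no re-keying of the landed closers. [cite: Balaban1987RG1, (1.22) p.264 (bookkeeping)] -/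
theorem n26_B4lit_of_shadow {Rec Rec' : YMDAG.UVSplit.RecordPred N}
    (hsh : ∀ (F : T4Family) (D : FiniteEpsData F (Matrix.specialUnitaryGroup (Fin N) ℂ)) (w : WorldP), Rec F D w →
      ∃ D' : FiniteEpsData F (Matrix.specialUnitaryGroup (Fin N) ℂ), Rec' F D' w ∧ D'.βfun = D.βfun)
    (h26 : YMDAG.UVSplit.N26_B4lit Rec') : YMDAG.UVSplit.N26_B4lit Rec := fun F D w hw => by
  obtain ⟨D', h', hβ⟩ := hsh F D w hw
  rw [← hβ]
  exact h26 F D' w h'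

end Transfer

/-! ## §4 (v1.1, append-only) N26 AT THE RECORD CHARTED BY DEFINITION `Node00.IsRecordOfRecord₈R` (n23-b's `Node00/ChartOfRecord.lean`, p419544):
the socket inputs DISPLAYED AT THE CHART OF RECORD `ρ8 := suChartMap N`, standard basis — chair R445 (A)(a2)'s «displayed non-degenerate chart
instance of record», for every `N` (non-degenerate for `2 ≤ N`: `Node00.suChartMap_ne_zero`) -/

section Rechart

open Literature.MathematicalPhysics.QuantumFieldTheory.Balaban1983to89.Node00 (suChartMap suChartDim)

variable (F : T4Family) (N : ℕ) [NeZero N]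

/-- **N26 AT A ₈R RECORD, SOCKET INPUTS DISPLAYED AT THE CHART OF RECORD**: for `(D, w)` a Stage-8 record charted by definition, the (D4) socket inputs
for the RE-CHARTED parameter's own merged term family `𝓝 := mergedTermFamilyMat F N (chi7 F N θ.rechart) θ.εbg`, read through the chart of record
`suChartMap N` with the standard basis `Pi.basisFun ℝ (Fin (suChartDim N))` (so `β = betaOfRecord₈ F N θ.rechart` by `Node00.betaOfRecord₈_rechart`,
`rfl`) — one-loop kernels `P0` pinned on `beta0OfMerged … θ.v₀`, (5.10), leaf kernels `A1` with [II]-(2.38)∕(190) records on the world's window, the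
localized representation `hrep`, the side conditions, (C-pt) — asked of every admissible θ realising the datum, give N26's literal (gen 2's
`n26_datumOfRecord₈` at `θ.rechart`).  Declared hypotheses (version-valued at Stage 8: this seat's [LOCATED-B4-VERSION], def-B's D-defB-3 ∕ «version-valued
for now», pub-ymgap INBOX l.10515 ∕ l.10740); instance 0∕1; N26 NOT discharged.
[cite: Balaban1987RG1, (1.7) p.261 and (1.20)-(1.22) p.264; Balaban1988RG2Cluster, Lemma 3 (2.38) p.20] -/
theorem n26_of_isRecordOfRecord₈R {D : FiniteEpsData F (Matrix.specialUnitaryGroup (Fin N) ℂ)} {w : WorldP}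
    (h : IsRecordOfRecord₈R F N D w)
    (hin : ∀ (θ : Stage8Params F N), θ.Admissible → D = datumOfRecord₅ F N (θ.rechart.toStage5 F N) → w.γ ≤ θ.γ →
      ∃ (M : ℕ) (_ : NeZero M) (c : B13.Consts) (ℓ α₂ : ℝ) (q : Consts190) (P0 : ℕ → Pt 4 → ℝ)
        (A1 : (k : ℕ) → (Fin (k + 1) → ℝ) → LDom 4 → Pt 4 → ℝ),
        (∀ k, beta0OfMerged (betaMerged F (mergedTermFamilyMat F N (chi7 F N θ.rechart) θ.εbg) (suChartMap N)
            (Pi.basisFun ℝ (Fin (suChartDim N)))) θ.v₀ k = B12Beta.secondMoment (fun _ _ => P0 k) 0 1) ∧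
        (∀ k, ∃ C δ₁ : ℝ, 0 < δ₁ ∧ B12Sec2to5.Decay510 (P0 k) C δ₁) ∧
        (∀ k (p : Fin (k + 1) → ℝ), p ∈ Box w.γ k → ∀ z : Pt 4,
          polLimit F (k + 1) (fun K => mergedTermFamilyMat F N (chi7 F N θ.rechart) θ.εbg k p K) (suChartMap N)
              (Pi.basisFun ℝ (Fin (suChartDim N))) 0 1 z = P0 k z + limKernel (A1 k p) z) ∧
        (∀ k (p : Fin (k + 1) → ℝ), p ∈ Box w.γ k → Nonempty (PolLeavesTFac190H 4 M (A1 k p) c ℓ α₂ q)) ∧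
        CondsL 4 c ℓ ∧ c.R22gen ℓ ∧ q.Valid c.δ₀ ∧ SignsL c α₂ q.B₃ ∧
        (∀ k (z : Pt 4), ContinuousOn (fun p : Fin (k + 1) → ℝ =>
          polLimit F (k + 1) (fun K => mergedTermFamilyMat F N (chi7 F N θ.rechart) θ.εbg k p K) (suChartMap N)
            (Pi.basisFun ℝ (Fin (suChartDim N))) 0 1 z) (Box w.γ k))) :
    ∃ γc : ℝ, 0 < γc ∧ BetaContH γc D.βfun := by
  obtain ⟨θ, hθ, hD, -, ⟨hγ0, hγle⟩, -, -⟩ := h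
  obtain ⟨M, _, c, ℓ, α₂, q, P0, A1, hβ0, hP0, hrep, hleaves, hC, h22, hq, hs, hcont⟩ := hin θ hθ hD hγle
  subst hD
  exact BalabanUVNodesN26AtRecord8.n26_datumOfRecord₈ F N θ.rechart hγ0 hγle P0 hβ0 hP0 A1 hrep
    (fun k p hp => Classical.choice (hleaves k p hp)) hC h22 hq hs hcont

/-- **`N26_B4lit` AT `Rec := IsRecordOfRecord₈R`, the ∀-FORM WITH THE DISPLAYED CHART OF RECORD** (R445 (A)(a2), every `N`), from the socket inputs of
`n26_of_isRecordOfRecord₈R`.  Also available abstractly as `n26_B4lit_mono Node00.isRecordOfRecord₈X_of_isRecordOfRecord₈R (n26_B4lit_rec8X …)`.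
Instance 0∕1; N26 NOT discharged. [cite: Balaban1987RG1, (1.20)-(1.22) p.264; Balaban1988RG2Cluster, Lemma 3 (2.38) p.20] -/
theorem n26_B4lit_rec8R
    (hin : ∀ (F : T4Family) (D : FiniteEpsData F (Matrix.specialUnitaryGroup (Fin N) ℂ)) (w : WorldP) (θ : Stage8Params F N),
      θ.Admissible → D = datumOfRecord₅ F N (θ.rechart.toStage5 F N) → w.γ ≤ θ.γ →
      ∃ (M : ℕ) (_ : NeZero M) (c : B13.Consts) (ℓ α₂ : ℝ) (q : Consts190) (P0 : ℕ → Pt 4 → ℝ)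
        (A1 : (k : ℕ) → (Fin (k + 1) → ℝ) → LDom 4 → Pt 4 → ℝ),
        (∀ k, beta0OfMerged (betaMerged F (mergedTermFamilyMat F N (chi7 F N θ.rechart) θ.εbg) (suChartMap N)
            (Pi.basisFun ℝ (Fin (suChartDim N)))) θ.v₀ k = B12Beta.secondMoment (fun _ _ => P0 k) 0 1) ∧
        (∀ k, ∃ C δ₁ : ℝ, 0 < δ₁ ∧ B12Sec2to5.Decay510 (P0 k) C δ₁) ∧
        (∀ k (p : Fin (k + 1) → ℝ), p ∈ Box w.γ k → ∀ z : Pt 4,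
          polLimit F (k + 1) (fun K => mergedTermFamilyMat F N (chi7 F N θ.rechart) θ.εbg k p K) (suChartMap N)
              (Pi.basisFun ℝ (Fin (suChartDim N))) 0 1 z = P0 k z + limKernel (A1 k p) z) ∧
        (∀ k (p : Fin (k + 1) → ℝ), p ∈ Box w.γ k → Nonempty (PolLeavesTFac190H 4 M (A1 k p) c ℓ α₂ q)) ∧
        CondsL 4 c ℓ ∧ c.R22gen ℓ ∧ q.Valid c.δ₀ ∧ SignsL c α₂ q.B₃ ∧
        (∀ k (z : Pt 4), ContinuousOn (fun p : Fin (k + 1) → ℝ =>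
          polLimit F (k + 1) (fun K => mergedTermFamilyMat F N (chi7 F N θ.rechart) θ.εbg k p K) (suChartMap N)
            (Pi.basisFun ℝ (Fin (suChartDim N))) 0 1 z) (Box w.γ k))) :
    YMDAG.UVSplit.N26_B4lit (fun F D w => IsRecordOfRecord₈R F N D w) :=
  fun F D w h => n26_of_isRecordOfRecord₈R F N h (hin F D w)

/-- The abstract route to the same record predicate: ₈R refines ₈X (`Node00.isRecordOfRecord₈X_of_isRecordOfRecord₈R`), so the ₈X ∀-form suffices
(`n26_B4lit_mono`). [cite: Balaban1987RG1, (1.22) p.264 (bookkeeping)] -/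
theorem n26_B4lit_rec8R_of_rec8X (h : YMDAG.UVSplit.N26_B4lit (fun F D w => IsRecordOfRecord₈X F N D w)) :
    YMDAG.UVSplit.N26_B4lit (fun F D w => IsRecordOfRecord₈R F N D w) :=
  n26_B4lit_mono (fun _ _ _ hw => isRecordOfRecord₈X_of_isRecordOfRecord₈R hw) h

end Rechart

end Summit.QuantumFields.YangMills.Theorems.BalabanUVNodesN26AtRecord8X

end
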